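import Mathlib
import HarnessLib
import Literature.Analysis.FluidPDE.VectorCalculus
import Literature.Analysis.FluidPDE.VectorCalculusProofs
import Literature.Analysis.FluidPDE.VorticityCalculus
import Literature.Analysis.FluidPDE.VorticityStretching
import Literature.Analysis.FluidPDE.LagrangianTimeDerivativeTools
import Literature.Analysis.FluidPDE.SverakLandauPoincare

/-!
# Route UnthreadedDoor · crux `PoloidalLiouville` (stmt-NavierStokesRegularity-1222, shared with
# route ThreadingFlux) · LINE «antidynamo» v2 — stub `stub_toroidalPotential` (2a), file 1/3:
# the radial pull-back of the sphere form `‖y‖⁻²(y × ω)` is CLOSED on `ℝ³ ∖ {0}`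

Seat ns-es-p1 g4 (director-ns KEY-NS #139 (b)), `--supports stmt-NavierStokesRegularity-1222 --as helper`;
formalisation plan of ns-qj-p1 g3 (`TOROIDAL-POTENTIAL-PLAN.md`, evidence on 1222). Registered skeleton of
record: planner ns-idea-6 g5, `PoloidalLiouville_antidynamo_birth_v2.lean` (sha16 `4ebf5683127baf3c`),
stub `StubToroidalPotential`: a vorticity field `ω = curl v(t)` tangent to every sphere about a centre has a
TOROIDAL (Mie–Chandrasekhar) POTENTIAL `T`, `ω = ∇T × (x − x₀)`.

THIS FILE (kinematics at a fixed time, centre `0`; no analysis on spheres). For a `C¹` field `W : ℝ³ → ℝ³`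
which is tangent to the spheres about the origin (`⟪y, W y⟫ = 0`) and divergence free (`tr DW = 0`):

* `inner_fderiv_sphereForm_symm` — the sphere form `F(y) = ‖y‖⁻² (y × W y)` (the candidate tangential
  gradient `∇_S T`) is CLOSED ON SPHERES: `⟪DF(p) a, b⟫ = ⟪DF(p) b, a⟫` for `a, b ⊥ p ≠ 0`. Three lines:
  the derivative of `‖y‖⁻²` along `a ⊥ p` vanishes; `a, b, W p` are coplanar (all `⊥ p`); and
  `⟪p × DW a, b⟫ − ⟪p × DW b, a⟫ = ⟪a × b, curl(p × DW ·)⟫ = ⟪a × b, (tr DW) p − DW p⟫ = 0` because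
  `tr DW = 0` and `DW(p) p ⊥ p` (differentiated tangency), so `a, b, DW p` are coplanar too.
* `inner_fderiv_pullbackForm_symm` — the RADIAL PULL-BACK `G(z) = ‖z‖⁻² (z × W((r/‖z‖) z))` of `F` along
  the projection `π_r(z) = (r/‖z‖) z` onto the sphere of radius `r ≠ 0` satisfies the pull-back identity
  `⟪G z, k⟫ = ⟪F(π_r z), Dπ_r(z) k⟫` (`inner_pullbackForm_eq`), hence (product rule for
  `z ↦ ⟪F(π_r z), ·⟫ ∘ Dπ_r(z)`, symmetry of `D²π_r`, tangency `Dπ_r(z) h ⊥ π_r z` from `‖π_r‖ ≡ |r|`, and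
  sphere-closedness of `F`) `DG(z)` is SYMMETRIC at every `z ≠ 0`: `G` is a closed `1`-form on `ℝ³ ∖ {0}`.
* `exists_primitive_pullbackForm` — by the tree's Poincaré lemma on the simply connected `ℝ³ ∖ {0}`
  (`Literature.Analysis.FluidPDE.Sverak2011.exists_gradient_eq_of_fderiv_symmetric`) `G = ∇Φ` there;
  `integral_inner_chord_eq_sub` — chord integrals of `G` compute `Φ q − Φ p` (path independence).

Files 2/3 and 3/3 build `T(t, x)` from chord integrals of `G` at `r = ‖x − x₀‖` (joint smoothness by
differentiation under the integral sign), prove `∇T × (x − x₀) = curl v` and `|T| ≤ πK`.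

HONEST FRAMING: elementary vector calculus about a HYPOTHETICAL bounded ancient solution's vorticity; it is
one kinematic stub of a line whose wall (`stub_scalarLiouville`) is OPEN. Nothing here bears on
`PoloidalLiouville`, on the UnthreadedDoor Target, or on Navier–Stokes regularity; no summit statement is
proved here.

References: G. Backus, Rev. Geophys. 24 (1986) 75–109, §2 (Mie representation of solenoidal fields tangent
to spheres); S. Chandrasekhar, Hydrodynamic and Hydromagnetic Stability (1961), App. III;
V. Šverák, J. Math. Sci. 179 (2011), §4 (Poincaré lemma on `ℝ³ ∖ {0}`, tree file `SverakLandauPoincare`).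
-/

noncomputable section

open Set Filter Function Metric
open scoped Topology RealInnerProductSpace ContDiff

set_option linter.dupNamespace false

namespace Summit.NavierStokesRegularity.NavierStokesRegularity.Theorems.PoloidalLiouville

open Literature.Analysis.FluidPDE

/-! ## Algebra of the cross product -/

/-- The four-vector identity `det(a,b,w) p = ⟪p,a⟫ (b × w) + ⟪p,b⟫ (w × a) + ⟪p,w⟫ (a × b)`. [folklore] -/
theorem inner_cross_smul_eq (a b w p : EuclideanSpace ℝ (Fin 3)) :
    ⟪cross a b, w⟫ • p = ⟪p, a⟫ • cross b w + ⟪p, b⟫ • cross w a + ⟪p, w⟫ • cross a b := by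
  ext i
  fin_cases i <;>
    simp [cross, cross_apply, PiLp.inner_apply, Fin.sum_univ_three] <;> ring

/-- Three vectors orthogonal to a non-zero vector are coplanar: `det(a,b,w) = 0`. [folklore] -/
theorem inner_cross_eq_zero_of_orthogonal {a b w p : EuclideanSpace ℝ (Fin 3)} (hp : p ≠ 0)
    (ha : ⟪p, a⟫ = 0) (hb : ⟪p, b⟫ = 0) (hw : ⟪p, w⟫ = 0) : ⟪cross a b, w⟫ = 0 := by
  have h := inner_cross_smul_eq a b w p
  rw [ha, hb, hw, zero_smul, zero_smul, zero_smul, add_zero, add_zero] at h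
  exact (smul_eq_zero.1 h).resolve_right hp

/-- `(x × w) × x = ‖x‖² w − ⟪x, w⟫ x`. [folklore] -/
theorem cross_cross_self (x w : EuclideanSpace ℝ (Fin 3)) :
    cross (cross x w) x = (‖x‖ ^ 2) • w - ⟪x, w⟫ • x := by
  ext i
  fin_cases i <;>
    simp [cross, cross_apply, PiLp.inner_apply, Fin.sum_univ_three,
      EuclideanSpace.real_norm_sq_eq] <;> ring

/-- `curlCLM (h ↦ p × M h) = (tr M) p − M p`. [folklore] -/
theorem curlCLM_crossCLM_comp_eq (p : EuclideanSpace ℝ (Fin 3))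
    (M : EuclideanSpace ℝ (Fin 3) →L[ℝ] EuclideanSpace ℝ (Fin 3)) :
    curlCLM ((crossCLM p).comp M) = (∑ i, M (EuclideanSpace.single i 1) i) • p - M p := by
  have hMa : M p = ∑ j, p j • M (EuclideanSpace.single j 1) := by
    conv_lhs => rw [show p = ∑ j, p j • EuclideanSpace.single j (1 : ℝ) from by
      simpa using ((EuclideanSpace.basisFun (Fin 3) ℝ).sum_repr p).symm]
    simp [map_sum, map_smul]
  rw [hMa]
  ext i
  fin_cases i <;>
    simp [curlCLM_apply, crossCLM_apply, cross, cross_apply, Fin.sum_univ_three] <;> ring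

/-! ## The sphere form `F = ‖y‖⁻² (y × W)` of a sphere-tangent solenoidal field is closed on spheres

For `W` differentiable at `p ≠ 0`, tangent to the spheres about `0` (`⟪y, W y⟫ = 0` for all `y`) and with
`tr DW(p) = 0`, the derivative of `F y = (‖y‖ ^ 2)⁻¹ • (y × W y)` at `p` is symmetric on tangent vectors:
`⟪DF(p) a, b⟫ = ⟪DF(p) b, a⟫ whenever `a, b ⊥ p`. -/

/-- Differentiating the tangency relation `⟪y, W y⟫ = 0`: `⟪h, W p⟫ + ⟪p, DW(p) h⟫ = 0`. [folklore] -/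
theorem inner_add_inner_fderiv_eq_zero_of_tangent {W : EuclideanSpace ℝ (Fin 3) → EuclideanSpace ℝ (Fin 3)}
    (htan : ∀ y, ⟪y, W y⟫ = 0) {p : EuclideanSpace ℝ (Fin 3)} (hW : DifferentiableAt ℝ W p)
    (h : EuclideanSpace ℝ (Fin 3)) : ⟪h, W p⟫ + ⟪p, fderiv ℝ W p h⟫ = 0 := by
  have h1 := (hasFDerivAt_id p).inner ℝ hW.hasFDerivAt
  have h2 : HasFDerivAt (fun y : EuclideanSpace ℝ (Fin 3) => ⟪id y, W y⟫) (0 : _ →L[ℝ] ℝ) p := by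
    have : (fun y : EuclideanSpace ℝ (Fin 3) => ⟪id y, W y⟫) = fun _ => (0 : ℝ) := funext htan
    rw [this]; exact hasFDerivAt_const 0 p
  have h3 := congrArg (fun L : EuclideanSpace ℝ (Fin 3) →L[ℝ] ℝ => L h) (h1.unique h2)
  simp only [ContinuousLinearMap.coe_comp, comp_apply, ContinuousLinearMap.prod_apply,
    fderivInnerCLM_apply, id_eq, ContinuousLinearMap.id_apply, zero_apply] at h3
  linarith [h3]

/-- The derivative of the sphere form `F y = (‖y‖²)⁻¹ • (y × W y)` at `p ≠ 0` in a direction `a ⊥ p`: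
`DF(p) a = (‖p‖²)⁻¹ • (a × W p + p × DW(p) a)` (the derivative of `‖y‖⁻²` along `a ⊥ p` vanishes). [folklore] -/
theorem fderiv_sphereForm_apply_of_orthogonal {W : EuclideanSpace ℝ (Fin 3) → EuclideanSpace ℝ (Fin 3)}
    {p : EuclideanSpace ℝ (Fin 3)} (hp : p ≠ 0) (hW : DifferentiableAt ℝ W p)
    {a : EuclideanSpace ℝ (Fin 3)} (ha : ⟪p, a⟫ = 0) :
    fderiv ℝ (fun y => (‖y‖ ^ 2)⁻¹ • cross y (W y)) p a =
      (‖p‖ ^ 2)⁻¹ • (cross a (W p) + cross p (fderiv ℝ W p a)) := by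
  have hne : ‖p‖ ^ 2 ≠ 0 := pow_ne_zero _ (norm_ne_zero_iff.2 hp)
  have hn : HasFDerivAt (fun y : EuclideanSpace ℝ (Fin 3) => ‖y‖ ^ 2) (2 • innerSL ℝ p) p :=
    (hasStrictFDerivAt_norm_sq p).hasFDerivAt
  have hφ : HasFDerivAt (fun y : EuclideanSpace ℝ (Fin 3) => (‖y‖ ^ 2)⁻¹)
      ((ContinuousLinearMap.toSpanSingleton ℝ (-((‖p‖ ^ 2) ^ 2)⁻¹)).comp (2 • innerSL ℝ p)) p :=
    (hasFDerivAt_inv hne).comp p hn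
  have hφa : fderiv ℝ (fun y : EuclideanSpace ℝ (Fin 3) => (‖y‖ ^ 2)⁻¹) p a = 0 := by
    rw [hφ.fderiv]
    simp [ha]
  have hc : HasFDerivAt (fun y => cross y (W y))
      (crossCLM.precompR (EuclideanSpace ℝ (Fin 3)) p (fderiv ℝ W p) +
        crossCLM.precompL (EuclideanSpace ℝ (Fin 3)) (ContinuousLinearMap.id ℝ _) (W p)) p :=
    hasFDerivAt_cross (hasFDerivAt_id p) hW.hasFDerivAt
  rw [fderiv_fun_smul hφ.differentiableAt hc.differentiableAt, hc.fderiv]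
  simp only [add_apply, smul_apply,
    ContinuousLinearMap.smulRight_apply, hφa, zero_smul, add_zero]
  simp [ContinuousLinearMap.precompR_apply, ContinuousLinearMap.compL_apply,
    ContinuousLinearMap.precompL_apply, add_comm]

/-- **Sphere-closedness of `F = ‖y‖⁻²(y × W)`.** If `W` is tangent to the spheres about `0`,
differentiable at `p ≠ 0` with trace-free derivative there (`div W (p) = 0`), then
`⟪DF(p) a, b⟫ = ⟪DF(p) b, a⟫` for all `a, b ⊥ p` (the surface curl of `F` on the sphere through `p`
vanishes). [folklore] -/
theorem inner_fderiv_sphereForm_symm {W : EuclideanSpace ℝ (Fin 3) → EuclideanSpace ℝ (Fin 3)}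
    (htan : ∀ y, ⟪y, W y⟫ = 0) {p : EuclideanSpace ℝ (Fin 3)} (hp : p ≠ 0)
    (hW : DifferentiableAt ℝ W p) (htr : ∑ i, fderiv ℝ W p (EuclideanSpace.single i 1) i = 0)
    {a b : EuclideanSpace ℝ (Fin 3)} (ha : ⟪p, a⟫ = 0) (hb : ⟪p, b⟫ = 0) :
    ⟪fderiv ℝ (fun y => (‖y‖ ^ 2)⁻¹ • cross y (W y)) p a, b⟫ =
      ⟪fderiv ℝ (fun y => (‖y‖ ^ 2)⁻¹ • cross y (W y)) p b, a⟫ := by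
  set M := fderiv ℝ W p with hM
  rw [fderiv_sphereForm_apply_of_orthogonal hp hW ha, fderiv_sphereForm_apply_of_orthogonal hp hW hb]
  simp only [inner_smul_left, inner_add_left, RCLike.conj_to_real]
  congr 1
  -- `W p ⊥ p`, so `a, b, W p` are coplanar
  have hWp : ⟪p, W p⟫ = 0 := htan p
  have h1 : ⟪cross a (W p), b⟫ = 0 := inner_cross_eq_zero_of_orthogonal hp ha hWp hb
  have h2 : ⟪cross b (W p), a⟫ = 0 := inner_cross_eq_zero_of_orthogonal hp hb hWp ha
  -- `M p ⊥ p` (differentiated tangency), so `a, b, M p` are coplanar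
  have hMp : ⟪p, M p⟫ = 0 := by
    have := inner_add_inner_fderiv_eq_zero_of_tangent htan hW p
    rw [hWp, zero_add] at this
    exact this
  have h3 : ⟪cross a b, M p⟫ = 0 := inner_cross_eq_zero_of_orthogonal hp ha hb hMp
  -- `⟪p × M a, b⟫ − ⟪p × M b, a⟫ = ⟪a × b, curl (p × M ·)⟫ = ⟪a × b, (tr M) p − M p⟫ = 0`
  have h4 : ⟪cross p (M a), b⟫ - ⟪cross p (M b), a⟫ = 0 := by
    have h := inner_cross_curlCLM a b ((crossCLM p).comp M)
    rw [curlCLM_crossCLM_comp_eq, htr, zero_smul, zero_sub, inner_neg_right, h3, neg_zero] at h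
    simp only [ContinuousLinearMap.coe_comp, comp_apply, crossCLM_apply] at h
    linarith [h, real_inner_comm (cross p (M a)) b, real_inner_comm (cross p (M b)) a]
  rw [h1, h2]
  linarith

/-! ## The radial pull-back `G(z) = ‖z‖⁻² (z × W(r z/‖z‖))` is a closed form on `ℝ³ ∖ {0}`

`G` is the pull-back of the sphere form `F` along the radial projection `π_r(z) = (r/‖z‖) z` onto
the sphere of radius `r`: `⟪G z, k⟫ = ⟪F (π_r z), Dπ_r(z) k⟫`. Pull-back commutes with the exterior
derivative, so `DG(z)` is symmetric for `z ≠ 0`. -/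

/-- The radial projection `π_r(y) = (r/‖y‖) y` is smooth away from the origin. [folklore] -/
theorem contDiffAt_radialProj (r : ℝ) {n : WithTop ℕ∞} {y : EuclideanSpace ℝ (Fin 3)} (hy : y ≠ 0) :
    ContDiffAt ℝ n (fun y : EuclideanSpace ℝ (Fin 3) => (r / ‖y‖) • y) y :=
  (contDiffAt_const.div (contDiffAt_norm ℝ hy) (norm_ne_zero_iff.2 hy)).smul contDiffAt_id

/-- `‖π_r(y)‖ = |r|` for `y ≠ 0`. [folklore] -/
theorem norm_radialProj {r : ℝ} {y : EuclideanSpace ℝ (Fin 3)} (hy : y ≠ 0) :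
    ‖(r / ‖y‖) • y‖ = |r| := by
  rw [norm_smul, Real.norm_eq_abs, abs_div, abs_norm, div_mul_cancel₀ _ (norm_ne_zero_iff.2 hy)]

/-- The derivative of the radial projection is tangent to the sphere: `⟪π_r(z), Dπ_r(z) h⟫ = 0`
(`‖π_r‖² ≡ r²` near `z ≠ 0`). [folklore] -/
theorem inner_radialProj_fderiv_eq_zero (r : ℝ) {z : EuclideanSpace ℝ (Fin 3)} (hz : z ≠ 0)
    (h : EuclideanSpace ℝ (Fin 3)) :
    ⟪(r / ‖z‖) • z, fderiv ℝ (fun y : EuclideanSpace ℝ (Fin 3) => (r / ‖y‖) • y) z h⟫ = 0 := by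
  have hd : DifferentiableAt ℝ (fun y : EuclideanSpace ℝ (Fin 3) => (r / ‖y‖) • y) z :=
    (contDiffAt_radialProj r (n := 1) hz).differentiableAt one_ne_zero
  -- `‖π y‖ ^ 2` is constant `= r ^ 2` near `z`
  have h1 : HasFDerivAt (fun y : EuclideanSpace ℝ (Fin 3) => ‖(r / ‖y‖) • y‖ ^ 2)
      (2 • (innerSL ℝ ((r / ‖z‖) • z)).comp
        (fderiv ℝ (fun y : EuclideanSpace ℝ (Fin 3) => (r / ‖y‖) • y) z)) z := by
    have hf : HasFDerivAt (fun x : EuclideanSpace ℝ (Fin 3) => ‖x‖ ^ 2)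
        (2 • innerSL ℝ ((r / ‖z‖) • z)) ((fun y : EuclideanSpace ℝ (Fin 3) => (r / ‖y‖) • y) z) :=
      (hasStrictFDerivAt_norm_sq _).hasFDerivAt
    have := HasFDerivAt.comp z (f := fun y : EuclideanSpace ℝ (Fin 3) => (r / ‖y‖) • y) hf
      hd.hasFDerivAt
    simpa [ContinuousLinearMap.smul_comp, Function.comp_def] using this
  have h2 : HasFDerivAt (fun y : EuclideanSpace ℝ (Fin 3) => ‖(r / ‖y‖) • y‖ ^ 2)
      (0 : EuclideanSpace ℝ (Fin 3) →L[ℝ] ℝ) z := by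
    refine (hasFDerivAt_const (r ^ 2) z).congr_of_eventuallyEq ?_
    filter_upwards [isOpen_ne.mem_nhds hz] with y hy
    rw [norm_radialProj hy, sq_abs]
  have h3 := congrArg (fun L : EuclideanSpace ℝ (Fin 3) →L[ℝ] ℝ => L h) (h1.unique h2)
  simp only [smul_apply, ContinuousLinearMap.coe_comp, comp_apply,
    innerSL_apply_apply, zero_apply, smul_eq_zero, OfNat.ofNat_ne_zero, false_or] at h3
  exact h3

/-- **The pull-back identity** `⟪G z, k⟫ = ⟪F (π_r z), Dπ_r(z) k⟫` for `z ≠ 0`, `r ≠ 0`. [folklore] -/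
theorem inner_pullbackForm_eq {W : EuclideanSpace ℝ (Fin 3) → EuclideanSpace ℝ (Fin 3)} {r : ℝ}
    (hr : r ≠ 0) {z : EuclideanSpace ℝ (Fin 3)} (hz : z ≠ 0) (k : EuclideanSpace ℝ (Fin 3)) :
    ⟪(‖z‖ ^ 2)⁻¹ • cross z (W ((r / ‖z‖) • z)), k⟫ =
      ⟪(‖(r / ‖z‖) • z‖ ^ 2)⁻¹ • cross ((r / ‖z‖) • z) (W ((r / ‖z‖) • z)),
        fderiv ℝ (fun y : EuclideanSpace ℝ (Fin 3) => (r / ‖y‖) • y) z k⟫ := by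
  have hzn : ‖z‖ ≠ 0 := norm_ne_zero_iff.2 hz
  have hρ : DifferentiableAt ℝ (fun y : EuclideanSpace ℝ (Fin 3) => r / ‖y‖) z :=
    ((contDiffAt_const (c := r)).div (contDiffAt_norm ℝ hz (n := 1)) hzn).differentiableAt
      one_ne_zero
  have hπ' : HasFDerivAt (fun y : EuclideanSpace ℝ (Fin 3) => (r / ‖y‖) • y)
      ((r / ‖z‖) • ContinuousLinearMap.id ℝ (EuclideanSpace ℝ (Fin 3)) +
        (fderiv ℝ (fun y : EuclideanSpace ℝ (Fin 3) => r / ‖y‖) z).smulRight z) z :=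
    hρ.hasFDerivAt.smul (hasFDerivAt_id z)
  have hcs : cross ((r / ‖z‖) • z) (W ((r / ‖z‖) • z)) = (r / ‖z‖) • cross z (W ((r / ‖z‖) • z)) := by
    rw [← crossCLM_apply, ← crossCLM_apply, map_smul, smul_apply]
  have h0 : ⟪cross z (W ((r / ‖z‖) • z)), z⟫ = 0 := by
    simp [cross, cross_apply, PiLp.inner_apply, Fin.sum_univ_three]; ring
  rw [hπ'.fderiv, norm_radialProj hz, sq_abs, hcs]
  simp only [add_apply, smul_apply, ContinuousLinearMap.id_apply,
    ContinuousLinearMap.smulRight_apply, inner_add_right, inner_smul_right, inner_smul_left,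
    RCLike.conj_to_real, h0, mul_zero, add_zero]
  field_simp

/-- **Closedness of the radial pull-back.** Let `W : ℝ³ → ℝ³` be `C¹`, tangent to the spheres about
the origin (`⟪y, W y⟫ = 0`) and divergence free (`tr DW ≡ 0` away from `0`), and let `r ≠ 0`. Then
the field `G(z) = ‖z‖⁻² • (z × W((r/‖z‖) z))` has a symmetric derivative at every `z ≠ 0`:
`⟪DG(z) h, k⟫ = ⟪DG(z) k, h⟫` (i.e. `curl G = 0` on `ℝ³ ∖ {0}`). [folklore] -/
theorem inner_fderiv_pullbackForm_symm {W : EuclideanSpace ℝ (Fin 3) → EuclideanSpace ℝ (Fin 3)}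
    (hW : ContDiff ℝ 1 W) (htan : ∀ y, ⟪y, W y⟫ = 0)
    (htr : ∀ p : EuclideanSpace ℝ (Fin 3), p ≠ 0 → ∑ i, fderiv ℝ W p (EuclideanSpace.single i 1) i = 0)
    {r : ℝ} (hr : r ≠ 0) {z : EuclideanSpace ℝ (Fin 3)} (hz : z ≠ 0) (h k : EuclideanSpace ℝ (Fin 3)) :
    ⟪fderiv ℝ (fun y : EuclideanSpace ℝ (Fin 3) => (‖y‖ ^ 2)⁻¹ • cross y (W ((r / ‖y‖) • y))) z h, k⟫ =
      ⟪fderiv ℝ (fun y : EuclideanSpace ℝ (Fin 3) => (‖y‖ ^ 2)⁻¹ • cross y (W ((r / ‖y‖) • y))) z k, h⟫ := by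
  set π : EuclideanSpace ℝ (Fin 3) → EuclideanSpace ℝ (Fin 3) := fun y => (r / ‖y‖) • y with hπ
  set F : EuclideanSpace ℝ (Fin 3) → EuclideanSpace ℝ (Fin 3) :=
    fun y => (‖y‖ ^ 2)⁻¹ • cross y (W y) with hF
  set G : EuclideanSpace ℝ (Fin 3) → EuclideanSpace ℝ (Fin 3) :=
    fun y => (‖y‖ ^ 2)⁻¹ • cross y (W (π y)) with hG
  have hWd : Differentiable ℝ W := hW.differentiable one_ne_zero
  have hπz : π z ≠ 0 := by
    rw [← norm_ne_zero_iff, hπ, norm_radialProj hz]; exact abs_ne_zero.2 hr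
  -- smoothness of `π` near `z`
  have hπc : ∀ y : EuclideanSpace ℝ (Fin 3), y ≠ 0 → ContDiffAt ℝ 2 π y := fun y hy =>
    contDiffAt_radialProj r hy
  have hπd : ∀ y : EuclideanSpace ℝ (Fin 3), y ≠ 0 → DifferentiableAt ℝ π y := fun y hy =>
    (hπc y hy).differentiableAt (by simp)
  have hm : HasFDerivAt (fderiv ℝ π) (fderiv ℝ (fderiv ℝ π) z) z :=
    (((hπc z hz).fderiv_right (m := 1) (by norm_num)).differentiableAt one_ne_zero).hasFDerivAt
  have hsymmπ : IsSymmSndFDerivAt ℝ π z := (hπc z hz).isSymmSndFDerivAt (by simp)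
  -- differentiability of `F` at `π z` and of `G` at `z`
  have hφ : ∀ p : EuclideanSpace ℝ (Fin 3), p ≠ 0 →
      DifferentiableAt ℝ (fun y : EuclideanSpace ℝ (Fin 3) => (‖y‖ ^ 2)⁻¹) p := fun p hp =>
    (((contDiffAt_norm ℝ hp (n := 1)).pow 2).differentiableAt one_ne_zero).inv
      (pow_ne_zero _ (norm_ne_zero_iff.2 hp))
  have hFd : DifferentiableAt ℝ F (π z) :=
    (hφ _ hπz).smul ((hasFDerivAt_cross (hasFDerivAt_id _) (hWd _).hasFDerivAt).differentiableAt)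
  have hGd : DifferentiableAt ℝ G z :=
    (hφ _ hz).smul ((hasFDerivAt_cross (hasFDerivAt_id _)
      (((hWd _).hasFDerivAt).comp z (hπd z hz).hasFDerivAt)).differentiableAt)
  -- the `1`-form `β = π^* F♭` and its derivative
  have hℓ : HasFDerivAt (fun y => innerSL ℝ (F (π y)))
      ((innerSL ℝ : EuclideanSpace ℝ (Fin 3) →L[ℝ] EuclideanSpace ℝ (Fin 3) →L[ℝ] ℝ).comp
        ((fderiv ℝ F (π z)).comp (fderiv ℝ π z))) z :=
    (innerSL ℝ : EuclideanSpace ℝ (Fin 3) →L[ℝ] EuclideanSpace ℝ (Fin 3) →L[ℝ] ℝ).hasFDerivAt.comp z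
      (hFd.hasFDerivAt.comp z (hπd z hz).hasFDerivAt)
  have hβ := hℓ.clm_comp hm
  -- `innerSL ∘ G = β` near `z`
  have heq : (fun y => innerSL ℝ (G y)) =ᶠ[𝓝 z] fun y => (innerSL ℝ (F (π y))).comp (fderiv ℝ π y) := by
    filter_upwards [isOpen_ne.mem_nhds hz] with y hy
    ext k
    simp only [innerSL_apply_apply, ContinuousLinearMap.coe_comp, comp_apply]
    exact inner_pullbackForm_eq hr hy k
  have hG' : HasFDerivAt (fun y => innerSL ℝ (G y))
      ((innerSL ℝ : EuclideanSpace ℝ (Fin 3) →L[ℝ] EuclideanSpace ℝ (Fin 3) →L[ℝ] ℝ).comp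
        (fderiv ℝ G z)) z :=
    (innerSL ℝ : EuclideanSpace ℝ (Fin 3) →L[ℝ] EuclideanSpace ℝ (Fin 3) →L[ℝ] ℝ).hasFDerivAt.comp z
      hGd.hasFDerivAt
  have hD : (innerSL ℝ : EuclideanSpace ℝ (Fin 3) →L[ℝ] EuclideanSpace ℝ (Fin 3) →L[ℝ] ℝ).comp
      (fderiv ℝ G z) = _ := hG'.unique (hβ.congr_of_eventuallyEq heq)
  have key : ∀ u v : EuclideanSpace ℝ (Fin 3), ⟪fderiv ℝ G z u, v⟫ =
      ⟪F (π z), fderiv ℝ (fderiv ℝ π) z u v⟫ +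
        ⟪fderiv ℝ F (π z) (fderiv ℝ π z u), fderiv ℝ π z v⟫ := fun u v => by
    have := congrArg (fun L : EuclideanSpace ℝ (Fin 3) →L[ℝ] EuclideanSpace ℝ (Fin 3) →L[ℝ] ℝ =>
      L u v) hD
    simpa [ContinuousLinearMap.compL_apply] using this
  rw [key, key, hsymmπ.eq h k]
  congr 1
  -- tangent vectors `Dπ h, Dπ k ⊥ π z`; sphere-closedness of `F`
  exact inner_fderiv_sphereForm_symm htan hπz (hWd _) (htr _ hπz)
    (inner_radialProj_fderiv_eq_zero r hz h) (inner_radialProj_fderiv_eq_zero r hz k)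

/-! ## A primitive of the pull-back form on `ℝ³ ∖ {0}`, and chord integrals -/

/-- The radial pull-back field `G(z) = ‖z‖⁻² • (z × W((r/‖z‖) z))` is smooth away from the origin
when `W` is smooth. [folklore] -/
theorem contDiffAt_pullbackForm {W : EuclideanSpace ℝ (Fin 3) → EuclideanSpace ℝ (Fin 3)}
    {n : WithTop ℕ∞} (hW : ContDiff ℝ n W) (r : ℝ) {z : EuclideanSpace ℝ (Fin 3)} (hz : z ≠ 0) :
    ContDiffAt ℝ n
      (fun y : EuclideanSpace ℝ (Fin 3) => (‖y‖ ^ 2)⁻¹ • cross y (W ((r / ‖y‖) • y))) z := by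
  have hφ : ContDiffAt ℝ n (fun y : EuclideanSpace ℝ (Fin 3) => (‖y‖ ^ 2)⁻¹) z :=
    ((contDiffAt_norm ℝ hz).pow 2).inv (pow_ne_zero _ (norm_ne_zero_iff.2 hz))
  have hc : ContDiffAt ℝ n (fun y : EuclideanSpace ℝ (Fin 3) => crossCLM y (W ((r / ‖y‖) • y))) z :=
    (crossCLM.contDiff.contDiffAt.comp z contDiffAt_id).clm_apply
      (hW.contDiffAt.comp z (contDiffAt_radialProj r hz))
  exact hφ.smul hc

/-- **A primitive of the pull-back form.** For `W` smooth, sphere-tangent and divergence free and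
`r ≠ 0`, the closed field `G(z) = ‖z‖⁻² • (z × W((r/‖z‖) z))` is a gradient on `ℝ³ ∖ {0}`
(tree Poincaré lemma `Sverak2011.exists_gradient_eq_of_fderiv_symmetric`). [folklore] -/
theorem exists_primitive_pullbackForm {W : EuclideanSpace ℝ (Fin 3) → EuclideanSpace ℝ (Fin 3)}
    (hW : ContDiff ℝ ∞ W) (htan : ∀ y, ⟪y, W y⟫ = 0)
    (htr : ∀ p : EuclideanSpace ℝ (Fin 3), p ≠ 0 → ∑ i, fderiv ℝ W p (EuclideanSpace.single i 1) i = 0)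
    {r : ℝ} (hr : r ≠ 0) :
    ∃ Φ : EuclideanSpace ℝ (Fin 3) → ℝ, ∀ z : EuclideanSpace ℝ (Fin 3), z ≠ 0 →
      HasFDerivAt Φ
        (innerSL ℝ ((‖z‖ ^ 2)⁻¹ • cross z (W ((r / ‖z‖) • z)))) z := by
  have hV : ContDiffOn ℝ (⊤ : ℕ∞)
      (fun y : EuclideanSpace ℝ (Fin 3) => (‖y‖ ^ 2)⁻¹ • cross y (W ((r / ‖y‖) • y))) {x | x ≠ 0} :=
    fun y hy => (contDiffAt_pullbackForm hW r hy).contDiffWithinAt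
  obtain ⟨Φ, -, hΦ⟩ := Sverak2011.exists_gradient_eq_of_fderiv_symmetric hV
    (fun z hz h k => inner_fderiv_pullbackForm_symm (hW.of_le (by norm_cast)) htan htr hr hz h k)
  exact ⟨Φ, hΦ⟩

/-- **Chord integrals of a gradient.** If `Φ` has derivative `⟪G z, ·⟫` at every point of a
set `S` on which `G` is continuous, and the segment `[p, q]` lies in `S`, then
`∫₀¹ ⟪G(p + s(q − p)), q − p⟫ ds = Φ q − Φ p`. [folklore] -/
theorem integral_inner_chord_eq_sub {S : Set (EuclideanSpace ℝ (Fin 3))}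
    {Φ : EuclideanSpace ℝ (Fin 3) → ℝ} {G : EuclideanSpace ℝ (Fin 3) → EuclideanSpace ℝ (Fin 3)}
    (hΦ : ∀ z ∈ S, HasFDerivAt Φ (innerSL ℝ (G z)) z) (hG : ContinuousOn G S)
    {p q : EuclideanSpace ℝ (Fin 3)} (hseg : ∀ s ∈ Icc (0 : ℝ) 1, p + s • (q - p) ∈ S) :
    ∫ s in (0 : ℝ)..1, ⟪G (p + s • (q - p)), q - p⟫ = Φ q - Φ p := by
  have hγ : ∀ s : ℝ, HasDerivAt (fun s : ℝ => p + s • (q - p)) (q - p) s := fun s => by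
    simpa using ((hasDerivAt_id s).smul_const (q - p)).const_add p
  have hderiv : ∀ s ∈ uIcc (0 : ℝ) 1,
      HasDerivAt (fun s : ℝ => Φ (p + s • (q - p))) ⟪G (p + s • (q - p)), q - p⟫ s := by
    intro s hs
    rw [uIcc_of_le zero_le_one] at hs
    have := (hΦ _ (hseg s hs)).comp_hasDerivAt s (hγ s)
    simpa [Function.comp_def] using this
  have hcont : ContinuousOn (fun s : ℝ => ⟪G (p + s • (q - p)), q - p⟫) (uIcc (0 : ℝ) 1) := by
    rw [uIcc_of_le zero_le_one]
    refine ContinuousOn.inner (hG.comp ?_ hseg) continuousOn_const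
    exact (continuous_const.add (continuous_id.smul continuous_const)).continuousOn
  rw [intervalIntegral.integral_eq_sub_of_hasDerivAt hderiv (hcont.intervalIntegrable)]
  simp

end Summit.NavierStokesRegularity.NavierStokesRegularity.Theorems.PoloidalLiouville

end
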